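import Summits.Ventures.CertifiedManyBodySolver.Observables.PairLROTowerCeilingAux
import Summits.Ventures.CertifiedManyBodySolver.Observables.PairLROTowerCeilingCert
import Literature.MathematicalPhysics.QuantumLattice.HubbardTTPrimeTorusFreeEnergyConcavity
import HarnessLib

/-!
# The sharp one-point ceiling with auxiliary CHORD rows, consumers I: dictionary of Hamiltonian shifts, orbit-state
# form, and the ANCHOR-RAY transport («BOX1-A0T-CHORD» sentence)

HONEST FRAMING: first certified bounds on pairing observables; not a superconductivity verdict; a ceiling route,
never presence; nothing in this file is a number. Crew hubbard-obs (D-0042), seat hubbard-obs-p1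
(`prover-hubbard-obs-p1-g14-0`); pen RULING (hq) d261 (hq2). Zero compute; no definition; no named fact; no `sorry`.

PairLROTowerCeilingAux proved the Koma–Tasaki ceiling `liminf_k u_k ≤ M²` from a one-point bound (OP1) carrying
auxiliary HAMILTONIAN-DIFFERENCE rows `Σ_j ρ_j (w_j − Re⟨ζ,(H_L(θ) − H_L(θ_j))ζ⟩/(δ_j L²))`, discharged by the chords
`e(θ; n) − e(θ_j; n) ≤ δ_j w_j`. This file supplies the shapes a typed leaf consumes:
* dictionary: `hubbardTorusTT'_sub_hubbardTorusTT'_of_U` / `_of_tp` / **`hubbardTorusTT'_ray`** — the auxiliary rows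
  are `U`-, `t'`- and ray-shifts of `H_L` (double occupancy `(U₁−U₂)·D_L`, diagonal hopping `(t'₁−t'₂)·H^{diag}_L(1,0)`,
  and box-eng-3's single-ray recipe `H_L(θ₀) = H_L(θ) + s·(H_L(θ) − H_L(θ₁))` for `θ₀ = θ + s(θ − θ₁)`);
* `liminf_pairFieldLRO_le_sq_of_onePoint_orbitState_bound_TT'_aux` — orbit-state form of the family theorem
  (right-hand side `Re ω̄_ζ(Γ(−Δ_g^{loc}))`, the shape of the typed OP1-E claim nodes);
* **`liminf_pairFieldLRO_le_sq_of_anchor_orbitState_bound_ray_TT'`** — ANCHOR-RAY TRANSPORT: an anchor one-point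
  node at `θ₀ = θ + s(θ − θ₁)` (all unit `ζ`, `κ ≥ 0`), a cap `cap ≥ e(θ;n)` and a floor `lo ≤ e(θ₁;n)` (`U, U₁ ≥ 0`,
  `s > 0`, `0 < n < 2`) give at the TARGET `θ`: `liminf_k u_k ≤ (c − A − κ[(cap − u₀) + s(cap − lo)] + (Σμ)(n/2 − ν))²`
  for every family of unit `(rectN n L, 0)`-sector ground states of `H_L(θ)` (box-eng-3's chord-box recipe, 2026-08-27).
The certificate form (one identity in `𝔄_{Λ'}` with auxiliary energy rows) is PairLROTowerCeilingAuxCert.lean.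
References: T. Koma, H. Tasaki, J. Stat. Phys. 76 (1994) 745, Theorem 5 [KomaTasaki1994]; J. Wang et al., PRX 14 (2024)
031006, §III [WangEtAl2024]; H. Xu et al., Science 384 (2024) eadh7691, eq. (1) [XuEtAl2024]; O. Bratteli, D. W. Robinson,
*Operator Algebras and Quantum Statistical Mechanics 2* (1997) §6.2.4 [BratteliRobinsonII1997].
-/

noncomputable section

namespace Summit.Ventures.CertifiedManyBodySolver.Observables

open Matrix Complex Finset Literature.MathematicalPhysics.QuantumLattice Literature.Probability.LatticeModels
open Literature.MathematicalPhysics.QuantumLattice.HubbardWave0 ThermodynamicLimit Filter Topology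
open Literature.MathematicalPhysics.QuantumManyBody.StateRelaxation
open Summit.Ventures.CertifiedManyBodySolver.Transport
open scoped ComplexOrder ComplexConjugate BigOperators

/-! ### §0  Dictionary: the auxiliary rows are `U`-, `t'`- and ray-shifts of `H_L` -/

section Dictionary

variable (L : ℕ)

/-- `U`-shift: `H_L(t,t',U₁) − H_L(t,t',U₂) = (U₁ − U₂)·D_L`, `D_L = Σ_x n_{x↑}n_{x↓}` — a double-occupancy letter box
is a `U`-shifted auxiliary row. [cite: XuEtAl2024, eq. (1)] -/
theorem hubbardTorusTT'_sub_hubbardTorusTT'_of_U (t t' U₁ U₂ : ℝ) :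
    hubbardTorusTT' L t t' U₁ - hubbardTorusTT' L t t' U₂ =
      ((U₁ - U₂ : ℝ) : ℂ) • ∑ x : FermionTorus 2 L, numberOp x 0 * numberOp x 1 := by
  rw [hubbardTorusTT'_eq_smul_add, hubbardTorusTT'_eq_smul_add]
  push_cast
  module

/-- `t'`-shift: `H_L(t,t'₁,U) − H_L(t,t'₂,U) = (t'₁ − t'₂)·H_L^{diag}(1,0)` (the unit diagonal hopping
Hamiltonian) — a diagonal-hopping letter box is a `t'`-shifted auxiliary row. [cite: XuEtAl2024, eq. (1)] -/
theorem hubbardTorusTT'_sub_hubbardTorusTT'_of_tp (t t'₁ t'₂ U : ℝ) :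
    hubbardTorusTT' L t t'₁ U - hubbardTorusTT' L t t'₂ U =
      ((t'₁ - t'₂ : ℝ) : ℂ) • hamiltonian (fermionTorusDiagGraph L) 1 0 := by
  rw [hubbardTorusTT'_eq_smul_add, hubbardTorusTT'_eq_smul_add]
  push_cast
  module

/-- **The ray identity** (box-eng-3's single-auxiliary-point recipe): for `θ₀ = θ + s(θ − θ₁)` componentwise,
`H_L(θ₀) = H_L(θ) + s·(H_L(θ) − H_L(θ₁))` — an anchor certificate at `θ₀` IS a one-point bound at `θ` with one
auxiliary Hamiltonian-difference row towards `θ₁`. [cite: XuEtAl2024, eq. (1)] -/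
theorem hubbardTorusTT'_ray (t t' U t₁ t'₁ U₁ s : ℝ) :
    hubbardTorusTT' L (t + s * (t - t₁)) (t' + s * (t' - t'₁)) (U + s * (U - U₁)) =
      hubbardTorusTT' L t t' U + (s : ℂ) • (hubbardTorusTT' L t t' U - hubbardTorusTT' L t₁ t'₁ U₁) := by
  rw [hubbardTorusTT'_eq_smul_add, hubbardTorusTT'_eq_smul_add, hubbardTorusTT'_eq_smul_add]
  push_cast
  module

end Dictionary

/-! ### §1  Families of sector ground states: orbit-state form and the anchor-ray transport -/

section Family

variable (g : Site 2 → ℝ)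

/-- **Orbit-state form with auxiliary chord rows, sharp constant.** As
`liminf_pairFieldLRO_le_sq_of_onePoint_orbitState_bound_TT'` (PairLROTowerCeilingCert) with the auxiliary
Hamiltonian-difference rows `Σ_j ρ_j(w_j − Re⟨ζ,(H_L(θ) − H_L(θ_j))ζ⟩/(δ_jL²))` on the left of the one-point bound and
the chord premises `e(θ;n) − e(θ_j;n) ≤ δ_j w_j` (`U_j ≥ 0`, `δ_j > 0`, `ρ_j ≥ 0`, `0 < n < 2`): conclusion
`liminf u_k ≤ (c − A + (Σμ)(n/2 − ν))²`. [cite: KomaTasaki1994, Theorem 5] [cite: BratteliRobinsonII1997, §6.2.4] -/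
theorem liminf_pairFieldLRO_le_sq_of_onePoint_orbitState_bound_TT'_aux (t t' : ℝ) {U n : ℝ} (hU : 0 ≤ U)
    (hn0 : 0 < n) (hn2 : n < 2) {c A κ u ν : ℝ} (μ : Fin 2 → ℝ) (hκ : 0 ≤ κ)
    (hu : energyDensityTT' t t' U n ≤ u)
    {J : Type*} [Fintype J] (ta tpa Ua δa ρa wa : J → ℝ) (hUa : ∀ j, 0 ≤ Ua j) (hδa : ∀ j, 0 < δa j)
    (hρa : ∀ j, 0 ≤ ρa j)
    (hwa : ∀ j, energyDensityTT' t t' U n - energyDensityTT' (ta j) (tpa j) (Ua j) n ≤ δa j * wa j)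
    {S : Finset (DihedralGroup 4)} (hS : S.Nonempty)
    (hg : ∀ γ ∈ S, ∀ e ∈ insert (0 : Site 2) unitSteps, g (d4Vec γ e) = g e)
    {Λ' : Finset (Site 2)} (h0 : pairRegion (insert (0 : Site 2) unitSteps) 0 ⊆ Λ') (L₁ : ℕ)
    (hInj : ∀ L : ℕ, L₁ ≤ L → Set.InjOn (Torus.proj (d := 2) L) ↑Λ')
    (hbound : ∀ (L : ℕ) [NeZero L] (hL : L₁ ≤ L) (ζ : Fock (Orb (FermionTorus 2 L))), star ζ ⬝ᵥ ζ = 1 →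
      c - A + ∑ σ : Fin 2, μ σ *
          ((star ζ ⬝ᵥ ((∑ y : FermionTorus 2 L, numberOp y σ) *ᵥ ζ)).re / (L : ℝ) ^ 2 - ν) +
        κ * (u - (star ζ ⬝ᵥ (hubbardTorusTT' L t t' U *ᵥ ζ)).re / (L : ℝ) ^ 2) +
        ∑ j, ρa j * (wa j -
          (star ζ ⬝ᵥ ((hubbardTorusTT' L t t' U - hubbardTorusTT' L (ta j) (tpa j) (Ua j)) *ᵥ ζ)).re /
            (δa j * (L : ℝ) ^ 2)) ≤
        (orbitState (spaceGroupUnitary S) ζ (fermionEmbed (PolySite.toTorusEmb L (hInj L hL))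
          (-(fermionEmbed (PolySite.incl h0) (localPairAt (insert (0 : Site 2) unitSteps) g 0))))).re)
    (ψ : ∀ L, Fock (Orb (FermionTorus 2 L)))
    (hψ : ∀ L, IsGroundStateInSector (hubbardTorusTT' L t t' U) (rectN n L) 0 (ψ L))
    (hψ1 : ∀ L, star (ψ L) ⬝ᵥ ψ L = 1) :
    liminf (fun k : ℕ => (∑ x ∈ halfOpenBox 2 (2 * k), ∑ y ∈ halfOpenBox 2 (2 * k),
        torusPullback (pairFieldCorr g ψ) (2 * k) x y) / ((#(halfOpenBox 2 (2 * k)) : ℝ)) ^ 2) atTop ≤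
      (c - A + (∑ σ : Fin 2, μ σ) * (n / 2 - ν)) ^ 2 := by
  refine liminf_pairFieldLRO_le_sq_of_onePoint_variational_bound_TT'_aux g t t' hU hn0 hn2 μ hκ hu
    ta tpa Ua δa ρa wa hUa hδa hρa hwa L₁ ?_ ψ hψ hψ1
  intro L _ hL ζ hζ
  have h := hbound L hL ζ hζ
  rwa [fermionEmbed_neg, map_neg, Complex.neg_re,
    re_orbitState_spaceGroupUnitary_localPairAt g hS hg h0 (hInj L hL) ζ] at h

/-- **ANCHOR-RAY TRANSPORT (the «BOX1-A0T-CHORD» sentence, orbit-state form).** Let an ANCHOR one-point bound hold at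
`θ₀ = (t, t'₀, U₀)` for every unit vector of every large torus (the OP1-E node shape:
`c − A + Σ_σ μ_σ(Re⟨ζ,N_σζ⟩/L² − ν) + κ(u₀ − Re⟨ζ,H_L(θ₀)ζ⟩/L²) ≤ Re ω̄_ζ(Γ(−Δ_g^{loc}))`, `κ ≥ 0`). Let `θ = (t, t', U)`
(`U ≥ 0`) be a target point, `s > 0`, and `θ₁ = (t, t'₁, U₁)` (`U₁ ≥ 0`) the point on the ray with
`θ₀ = θ + s(θ − θ₁)`; let `cap ≥ e(θ; n)` and `lo ≤ e(θ₁; n)` (`0 < n < 2`). Then every family of unit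
`(rectN n L, 0)`-sector ground states of `H_L(θ)` has
`liminf_k u_k ≤ (c − A − κ[(cap − u₀) + s(cap − lo)] + (Σμ)(n/2 − ν))²`: the anchor's energy row is
`κ(cap − ⟨H_L(θ)⟩/L²) + κs((cap − lo) − ⟨H_L(θ) − H_L(θ₁)⟩/L²)` minus the constant `κ[(cap − u₀) + s(cap − lo)]`
(`hubbardTorusTT'_ray`), and the auxiliary row is discharged by the chord `e(θ) − e(θ₁) ≤ cap − lo`
(`liminf_pairFieldLRO_le_sq_of_onePoint_orbitState_bound_TT'_aux` with one auxiliary point).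
[cite: KomaTasaki1994, Theorem 5] [cite: BratteliRobinsonII1997, §6.2.4] -/
theorem liminf_pairFieldLRO_le_sq_of_anchor_orbitState_bound_ray_TT' (t : ℝ) {t'₀ U₀ t' U t'₁ U₁ s n : ℝ}
    (hU : 0 ≤ U) (hU₁ : 0 ≤ U₁) (hs : 0 < s) (hn0 : 0 < n) (hn2 : n < 2)
    (ht' : t'₀ = t' + s * (t' - t'₁)) (hUr : U₀ = U + s * (U - U₁))
    {c A κ u₀ ν cap lo : ℝ} (μ : Fin 2 → ℝ) (hκ : 0 ≤ κ)
    (hcap : energyDensityTT' t t' U n ≤ cap) (hlo : lo ≤ energyDensityTT' t t'₁ U₁ n)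
    {S : Finset (DihedralGroup 4)} (hS : S.Nonempty)
    (hg : ∀ γ ∈ S, ∀ e ∈ insert (0 : Site 2) unitSteps, g (d4Vec γ e) = g e)
    {Λ' : Finset (Site 2)} (h0 : pairRegion (insert (0 : Site 2) unitSteps) 0 ⊆ Λ') (L₁ : ℕ)
    (hInj : ∀ L : ℕ, L₁ ≤ L → Set.InjOn (Torus.proj (d := 2) L) ↑Λ')
    (hbound : ∀ (L : ℕ) [NeZero L] (hL : L₁ ≤ L) (ζ : Fock (Orb (FermionTorus 2 L))), star ζ ⬝ᵥ ζ = 1 →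
      c - A + ∑ σ : Fin 2, μ σ *
          ((star ζ ⬝ᵥ ((∑ y : FermionTorus 2 L, numberOp y σ) *ᵥ ζ)).re / (L : ℝ) ^ 2 - ν) +
        κ * (u₀ - (star ζ ⬝ᵥ (hubbardTorusTT' L t t'₀ U₀ *ᵥ ζ)).re / (L : ℝ) ^ 2) ≤
        (orbitState (spaceGroupUnitary S) ζ (fermionEmbed (PolySite.toTorusEmb L (hInj L hL))
          (-(fermionEmbed (PolySite.incl h0) (localPairAt (insert (0 : Site 2) unitSteps) g 0))))).re)
    (ψ : ∀ L, Fock (Orb (FermionTorus 2 L)))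
    (hψ : ∀ L, IsGroundStateInSector (hubbardTorusTT' L t t' U) (rectN n L) 0 (ψ L))
    (hψ1 : ∀ L, star (ψ L) ⬝ᵥ ψ L = 1) :
    liminf (fun k : ℕ => (∑ x ∈ halfOpenBox 2 (2 * k), ∑ y ∈ halfOpenBox 2 (2 * k),
        torusPullback (pairFieldCorr g ψ) (2 * k) x y) / ((#(halfOpenBox 2 (2 * k)) : ℝ)) ^ 2) atTop ≤
      (c - A - κ * ((cap - u₀) + s * (cap - lo)) + (∑ σ : Fin 2, μ σ) * (n / 2 - ν)) ^ 2 := by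
  have h := liminf_pairFieldLRO_le_sq_of_onePoint_orbitState_bound_TT'_aux g t t' hU hn0 hn2
    (c := c) (A := A + κ * ((cap - u₀) + s * (cap - lo))) (ν := ν) μ hκ hcap
    (J := Unit) (fun _ => t) (fun _ => t'₁) (fun _ => U₁) (fun _ => 1) (fun _ => κ * s) (fun _ => cap - lo)
    (fun _ => hU₁) (fun _ => one_pos) (fun _ => mul_nonneg hκ hs.le) (fun _ => by linarith) hS hg h0 L₁ hInj
    ?_ ψ hψ hψ1
  · have e : c - (A + κ * ((cap - u₀) + s * (cap - lo))) + (∑ σ : Fin 2, μ σ) * (n / 2 - ν) =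
        c - A - κ * ((cap - u₀) + s * (cap - lo)) + (∑ σ : Fin 2, μ σ) * (n / 2 - ν) := by ring
    rw [e] at h
    exact h
  · intro L _ hL ζ hζ
    have hb := hbound L hL ζ hζ
    have hray : hubbardTorusTT' L t t'₀ U₀ = hubbardTorusTT' L t t' U +
        (s : ℂ) • (hubbardTorusTT' L t t' U - hubbardTorusTT' L t t'₁ U₁) := by
      have h := hubbardTorusTT'_ray L t t' U t t'₁ U₁ s
      rwa [show t + s * (t - t) = t by ring, ← ht', ← hUr] at h
    rw [hray, add_mulVec, dotProduct_add, Complex.add_re, smul_mulVec, dotProduct_smul, smul_eq_mul,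
      Complex.re_ofReal_mul] at hb
    simp only [Finset.univ_unique, Finset.sum_singleton, one_mul]
    have hL2 : (0 : ℝ) < (L : ℝ) ^ 2 := by
      have : (0 : ℝ) < L := Nat.cast_pos.2 (Nat.pos_of_ne_zero (NeZero.ne L))
      positivity
    have key : c - (A + κ * ((cap - u₀) + s * (cap - lo))) +
        ∑ σ : Fin 2, μ σ * ((star ζ ⬝ᵥ ((∑ y : FermionTorus 2 L, numberOp y σ) *ᵥ ζ)).re / (L : ℝ) ^ 2 - ν) +
        κ * (cap - (star ζ ⬝ᵥ (hubbardTorusTT' L t t' U *ᵥ ζ)).re / (L : ℝ) ^ 2) +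
        κ * s * (cap - lo -
          (star ζ ⬝ᵥ ((hubbardTorusTT' L t t' U - hubbardTorusTT' L t t'₁ U₁) *ᵥ ζ)).re / (L : ℝ) ^ 2) =
      c - A + ∑ σ : Fin 2, μ σ * ((star ζ ⬝ᵥ ((∑ y : FermionTorus 2 L, numberOp y σ) *ᵥ ζ)).re / (L : ℝ) ^ 2 - ν) +
        κ * (u₀ - ((star ζ ⬝ᵥ (hubbardTorusTT' L t t' U *ᵥ ζ)).re +
          s * (star ζ ⬝ᵥ ((hubbardTorusTT' L t t' U - hubbardTorusTT' L t t'₁ U₁) *ᵥ ζ)).re) / (L : ℝ) ^ 2) := by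
      field_simp
      ring
    rw [key]
    exact hb

end Family

end Summit.Ventures.CertifiedManyBodySolver.Observables

end
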